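import Summits.NavierStokesRegularity.FunctionalMining.NoGo.TopBotEigSplitWallSides
import Summits.NavierStokesRegularity.FunctionalMining.NoGo.TopBotEigSplitWallPoly
import HarnessLib

/-!
# K28 — the concavity inequality `𝓘_q(u) ≥ 0` on `[1/3, 2/3]` at the sharp share `c = c_axi(q)`, for EVERY real `q ≥ 2`

search for candidate a priori estimates; no regularity claim.

One-variable real analysis over the tree toolkit K16 part 1 (`NoGo.TopBotEigSplitShareWallLine`: `lineNsq`, `cAxi`,
`axiB`, `cAxi_pos`), K25 (`cAxi_lt_axiB : c_axi(q) < B_q = ((q−1)/2)·6^{1−q/2}`) and the polynomial certificates K27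
(`wallJ_nonneg`, `wallJ_sub_nonneg`, `wallK_nonneg`, `wallGab_nonneg_piece24/46/610/tail`). Context (door D-K6 (c), general
real `q`): K24–K26 reduce the share window `Iic (c_axi q)` for a real `q ≥ 2` to `0 ≤ ρ_q` on `(1/3, 2/3)`; K29 reduces that,
via the flux identity `(s·ρ_q′)′ = −c(q−2)s^{q/2−3}(u(1−u))^{−q}·𝓘_q`, to the sign of

  `𝓘_q(u) = wallI q c u = u^{q−2}·J_q(u) + (1−u)^{q−2}·J_q(1−u) − 12·c·s^{q/2}·K_q(u)`,  `s = lineNsq u = 6u² − 6u + 2`.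

THIS file proves **`wallI_cAxi_nonneg : 2 ≤ q → 1/3 ≤ u ≤ 2/3 → 0 ≤ wallI q (c_axi q) u`**. Proof (for `u ≥ 1/2`;
`u ≤ 1/2` by the mirror symmetry `wallI_symm`), with `P = u(1−u) ∈ [2/9, 1/4]`, `r = q − 2 ≥ 0`:
(1) `c_axi(q) < B_q` (K25) and `s/6 ≤ P/2` give `12c·s^{q/2}K ≤ 6(q−1)sK·P^{r/2}·(1/2)^{r/2}` (`wall_entropy_term_le`);
(2) `u^r = P^{r/2}t`, `(1−u)^r = P^{r/2}/t` with `t = (u/(1−u))^{r/2} ≥ t₀ := 1 + (r/2)(1 − (1−u)/u) ≥ 1` (real Bernoulli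
`one_add_mul_le_rpow`: `x^a ≥ 1 + a(1 − 1/x)` from `exp y ≥ 1 + y`, `log x ≥ 1 − 1/x`);
(3) `tJ(u) + J(1−u)/t ≥ t₀J(u) + J(1−u)/t₀` since `J(u) ≥ max(J(1−u), 0)` (K27) (`wall_mono_step`);
(4) the convexity chords `(1/2)^{r/2} ≤ a + b·r` on `r ∈ [0,2], [2,4], [4,8]` and `≤ 1/16` for `r ≥ 8` (`half_rpow_le_chord`,
two-point convexity of `exp`);
(5) what is left is `4u²t₀·(t₀J(u) + J(1−u)/t₀ − 6(q−1)sK(a + b·r)) = G_{a,b}(q,u) ≥ 0` — K27's certificates.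
Margins (readings only, stdlib floats, `K28.margins7.py` in the evidence directory `pub-nsfunc-nogo/sieveld/wall/flow/`; the
proof uses none of them; v2 wording, Lean text unchanged from v1): the ratio (positive part)/(negative part) of the exact
inequality `𝓘_q(c_axi(q), u) ≥ 0` is `≥ 2.02` over `q ∈ [2, 60]` (spot values to `q = 400`) × `u ∈ [1/2, 2/3]`, least near
`q ≈ 3.06` at the wall `u = 2/3`; for the staged polynomial pieces `G_{a,b} ≥ 0` it is `≥ 1.29`, least near `q ≈ 3.6` at `u = 1/2`.
NOT claimed here: anything about `ρ_q`, (W) or `TopBotEigSplitting` (that is K29); nothing on `heatDissipation`.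
search for candidate a priori estimates; no regularity claim.
FILING (prove seat g27, REQUEST #44): declarations byte-identical to the no-go seat's staged `TopBotEigSplitWallIneq.STAGING.lean` 892a9fac045a7855; this line is the only addition.
-/

open Set

noncomputable section

namespace Summit.NavierStokesRegularity.FunctionalMining

namespace TopEig

/-! ## 1. The function `𝓘_q` -/

/-- **`𝓘_q(u) = u^{q−2}·J_q(u) + (1−u)^{q−2}·J_q(1−u) − 12·c·s^{q/2}·K_q(u)`**, `s = ‖A(u)‖² = lineNsq u`: the sign-carrying
factor of the flux derivative `(s·ρ_q′)′` (K29). [ours] -/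
def wallI (q c u : ℝ) : ℝ :=
  u ^ (q - 2) * wallJ q u + (1 - u) ^ (q - 2) * wallJ q (1 - u) - 12 * c * lineNsq u ^ (q / 2) * wallK q u

/-- Mirror symmetry `𝓘_q(1 − u) = 𝓘_q(u)`. [bookkeeping] -/
theorem wallI_symm (q c u : ℝ) : wallI q c (1 - u) = wallI q c u := by
  have hK : wallK q (1 - u) = wallK q u := by
    unfold wallK; ring
  have hs : lineNsq (1 - u) = lineNsq u := by
    unfold lineNsq; ring
  unfold wallI
  rw [sub_sub_cancel, hs, hK]
  ring

/-! ## 2. Real Bernoulli -/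

/-- Bernoulli for real exponents: `x^a ≥ 1 + a(1 − 1/x)` for `x > 0`, `a ≥ 0`
(`x^a = exp(a log x) ≥ 1 + a log x` and `log x ≥ 1 − 1/x`). [bookkeeping] -/
theorem one_add_mul_le_rpow {x a : ℝ} (hx : 0 < x) (ha : 0 ≤ a) :
    1 + a * (1 - x⁻¹) ≤ x ^ a := by
  rw [Real.rpow_def_of_pos hx]
  have h1 : 1 - x⁻¹ ≤ Real.log x := Real.one_sub_inv_le_log_of_pos hx
  have h2 : Real.log x * a + 1 ≤ Real.exp (Real.log x * a) := Real.add_one_le_exp _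
  have h3 := mul_le_mul_of_nonneg_left h1 ha
  linarith


/-! ## 3. The chord bounds `2^{−(q−2)/2} ≤ a + b(q − 2)` (two-point convexity of `x ↦ (1/2)^x = exp(x log ½)`) -/

/-- Two-point convexity of `x ↦ (1/2)^x = exp(x·log ½)` on `[a, b]`. [bookkeeping] -/
theorem half_rpow_le_chord {a b x : ℝ} (hab : a < b) (hax : a ≤ x) (hxb : x ≤ b) :
    (1 / 2 : ℝ) ^ x ≤ (b - x) / (b - a) * (1 / 2 : ℝ) ^ a + (x - a) / (b - a) * (1 / 2 : ℝ) ^ b := by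
  have hpos : (0 : ℝ) < 1 / 2 := by norm_num
  rw [Real.rpow_def_of_pos hpos, Real.rpow_def_of_pos hpos, Real.rpow_def_of_pos hpos]
  have hba : 0 < b - a := sub_pos.mpr hab
  have h1 : 0 ≤ (b - x) / (b - a) := div_nonneg (by linarith) hba.le
  have h2 : 0 ≤ (x - a) / (b - a) := div_nonneg (by linarith) hba.le
  have hne : b - a ≠ 0 := ne_of_gt hba
  have h3 : (b - x) / (b - a) + (x - a) / (b - a) = 1 := by
    field_simp; ring
  have key := convexOn_exp.2 (Set.mem_univ (Real.log (1 / 2) * a)) (Set.mem_univ (Real.log (1 / 2) * b))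
    h1 h2 h3
  simp only [smul_eq_mul] at key
  have harg : (b - x) / (b - a) * (Real.log (1 / 2) * a) + (x - a) / (b - a) * (Real.log (1 / 2) * b) =
      Real.log (1 / 2) * x := by
    field_simp
    ring
  rw [harg] at key
  exact key

/-- Chord on `q ∈ [2, 4]`: `2^{−(q−2)/2} ≤ 1 − (q − 2)/4`. [bookkeeping] -/
theorem half_rpow_chord24 {q : ℝ} (hq1 : 2 ≤ q) (hq2 : q ≤ 4) :
    (1 / 2 : ℝ) ^ ((q - 2) / 2) ≤ (1 : ℝ) + ((-1 : ℝ) / 4) * (q - 2) := by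
  have h := half_rpow_le_chord (a := 0) (b := 1) (x := (q - 2) / 2) one_pos (by linarith) (by linarith)
  rw [Real.rpow_zero, Real.rpow_one] at h
  have e : (1 - (q - 2) / 2) / (1 - 0) * 1 + ((q - 2) / 2 - 0) / (1 - 0) * (1 / 2 : ℝ) =
      (1 : ℝ) + ((-1 : ℝ) / 4) * (q - 2) := by ring
  exact h.trans_eq e

/-- Chord on `q ∈ [4, 6]`: `2^{−(q−2)/2} ≤ 3/4 − (q − 2)/8`. [bookkeeping] -/
theorem half_rpow_chord46 {q : ℝ} (hq1 : 4 ≤ q) (hq2 : q ≤ 6) :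
    (1 / 2 : ℝ) ^ ((q - 2) / 2) ≤ ((3 : ℝ) / 4) + ((-1 : ℝ) / 8) * (q - 2) := by
  have h := half_rpow_le_chord (a := 1) (b := 2) (x := (q - 2) / 2) one_lt_two (by linarith) (by linarith)
  rw [Real.rpow_one, Real.rpow_two] at h
  have e : (2 - (q - 2) / 2) / (2 - 1) * (1 / 2 : ℝ) + ((q - 2) / 2 - 1) / (2 - 1) * (1 / 2 : ℝ) ^ 2 =
      ((3 : ℝ) / 4) + ((-1 : ℝ) / 8) * (q - 2) := by ring
  exact h.trans_eq e

/-- `(1/2)^4 = 1/16` as a real power. [bookkeeping] -/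
theorem half_rpow_four : (1 / 2 : ℝ) ^ (4 : ℝ) = 1 / 16 := by
  rw [show (4 : ℝ) = ((4 : ℕ) : ℝ) by norm_num, Real.rpow_natCast]; norm_num

/-- Chord on `q ∈ [6, 10]`: `2^{−(q−2)/2} ≤ 7/16 − 3(q − 2)/64`. [bookkeeping] -/
theorem half_rpow_chord610 {q : ℝ} (hq1 : 6 ≤ q) (hq2 : q ≤ 10) :
    (1 / 2 : ℝ) ^ ((q - 2) / 2) ≤ ((7 : ℝ) / 16) + ((-3 : ℝ) / 64) * (q - 2) := by
  have h := half_rpow_le_chord (a := 2) (b := 4) (x := (q - 2) / 2) (by norm_num) (by linarith)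
    (by linarith)
  rw [Real.rpow_two, half_rpow_four] at h
  have e : (4 - (q - 2) / 2) / (4 - 2) * (1 / 2 : ℝ) ^ 2 + ((q - 2) / 2 - 2) / (4 - 2) * (1 / 16 : ℝ) =
      ((7 : ℝ) / 16) + ((-3 : ℝ) / 64) * (q - 2) := by ring
  exact h.trans_eq e

/-- Tail `q ≥ 10`: `2^{−(q−2)/2} ≤ 1/16`. [bookkeeping] -/
theorem half_rpow_tail {q : ℝ} (hq1 : 10 ≤ q) :
    (1 / 2 : ℝ) ^ ((q - 2) / 2) ≤ (1 / 16 : ℝ) + (0 : ℝ) * (q - 2) := by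
  have h : (1 / 2 : ℝ) ^ ((q - 2) / 2) ≤ (1 / 2 : ℝ) ^ (4 : ℝ) :=
    Real.rpow_le_rpow_of_exponent_ge (by norm_num) (by norm_num) (by linarith)
  rw [half_rpow_four] at h
  linarith

/-! ## 4. The piece lemma: from a chord and a polynomial certificate to `𝓘_q(u) ≥ 0` -/

/-- Step 1 of the piece lemma (the entropy term): for `c ≤ B_q`, `s = ‖A‖² > 0` with `s/6 ≤ P/2`,
`K ≥ 0` and a chord bound, `12·c·s^{q/2}·K ≤ 6(q−1)·s·K·P^{(q−2)/2}·(a + b(q−2))`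
(`B_q·s^{q/2} = 3(q−1)(s/6)^{q/2}` and `(s/6)^{(q−2)/2} ≤ (P/2)^{(q−2)/2}`). [bookkeeping] -/
theorem wall_entropy_term_le {q c s P K a b : ℝ} (hq : 2 ≤ q)
    (hcB : c ≤ (q - 1) / 2 * (6 : ℝ) ^ (1 - q / 2)) (hs0 : 0 < s) (hP0 : 0 ≤ P) (hs6 : s / 6 ≤ P * (1 / 2))
    (hK : 0 ≤ K) (hch : (1 / 2 : ℝ) ^ ((q - 2) / 2) ≤ a + b * (q - 2)) :
    12 * c * s ^ (q / 2) * K ≤ 6 * (q - 1) * s * K * (P ^ ((q - 2) / 2) * (a + b * (q - 2))) := by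
  have hr0 : 0 ≤ (q - 2) / 2 := by linarith
  have hq1 : 0 ≤ (q - 1) / 2 := by linarith
  have hPr : 0 ≤ P ^ ((q - 2) / 2) := Real.rpow_nonneg hP0 _
  have h6 : (6 : ℝ) ^ (1 - q / 2) * s ^ (q / 2) = 6 * ((s / 6) * (s / 6) ^ ((q - 2) / 2)) := by
    have hs6ne : s / 6 ≠ 0 := by positivity
    have h6q : (6 : ℝ) ^ (q / 2) ≠ 0 := (Real.rpow_pos_of_pos (by norm_num) _).ne'
    have hA : (s / 6) ^ ((q - 2) / 2) = (s / 6) ^ (q / 2) / (s / 6) := by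
      rw [show (q - 2) / 2 = q / 2 - 1 by ring, Real.rpow_sub (by positivity : (0 : ℝ) < s / 6),
        Real.rpow_one]
    rw [hA, Real.div_rpow hs0.le (by norm_num : (0 : ℝ) ≤ 6), Real.rpow_sub (by norm_num : (0 : ℝ) < 6),
      Real.rpow_one]
    field_simp
  have h8 : (s / 6) ^ ((q - 2) / 2) ≤ P ^ ((q - 2) / 2) * (a + b * (q - 2)) := by
    calc (s / 6) ^ ((q - 2) / 2) ≤ (P * (1 / 2)) ^ ((q - 2) / 2) :=
          Real.rpow_le_rpow (by positivity) hs6 hr0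
      _ = P ^ ((q - 2) / 2) * (1 / 2 : ℝ) ^ ((q - 2) / 2) := Real.mul_rpow hP0 (by norm_num)
      _ ≤ P ^ ((q - 2) / 2) * (a + b * (q - 2)) := mul_le_mul_of_nonneg_left hch hPr
  have hsq : 0 ≤ s ^ (q / 2) := Real.rpow_nonneg hs0.le _
  have hc1 : c * s ^ (q / 2) ≤ (q - 1) / 2 * (6 * ((s / 6) * (s / 6) ^ ((q - 2) / 2))) := by
    calc c * s ^ (q / 2) ≤ (q - 1) / 2 * (6 : ℝ) ^ (1 - q / 2) * s ^ (q / 2) :=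
          mul_le_mul_of_nonneg_right hcB hsq
      _ = (q - 1) / 2 * (6 * ((s / 6) * (s / 6) ^ ((q - 2) / 2))) := by rw [mul_assoc, h6]
  have hc2 : (q - 1) / 2 * (6 * ((s / 6) * (s / 6) ^ ((q - 2) / 2))) ≤
      (q - 1) / 2 * (6 * ((s / 6) * (P ^ ((q - 2) / 2) * (a + b * (q - 2))))) :=
    mul_le_mul_of_nonneg_left (mul_le_mul_of_nonneg_left
      (mul_le_mul_of_nonneg_left h8 (by positivity)) (by norm_num)) hq1
  have h12 := mul_le_mul_of_nonneg_right (hc1.trans hc2) (by positivity : (0 : ℝ) ≤ 12 * K)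
  calc 12 * c * s ^ (q / 2) * K = c * s ^ (q / 2) * (12 * K) := by ring
    _ ≤ (q - 1) / 2 * (6 * ((s / 6) * (P ^ ((q - 2) / 2) * (a + b * (q - 2))))) * (12 * K) := h12
    _ = 6 * (q - 1) * s * K * (P ^ ((q - 2) / 2) * (a + b * (q - 2))) := by ring

/-- Step 2 of the piece lemma (the power atoms): `u^{q−2} = P^{(q−2)/2}·t` and `(1−u)^{q−2} = P^{(q−2)/2}/t`
with `P = u(1−u)`, `t = (u/(1−u))^{(q−2)/2}`. [bookkeeping] -/
theorem wall_rpow_split {q u : ℝ} (hu0 : 0 < u) (hv0 : 0 < 1 - u) :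
    u ^ (q - 2) = (u * (1 - u)) ^ ((q - 2) / 2) * (u / (1 - u)) ^ ((q - 2) / 2) ∧
      (1 - u) ^ (q - 2) = (u * (1 - u)) ^ ((q - 2) / 2) / (u / (1 - u)) ^ ((q - 2) / 2) := by
  have hP0 : 0 ≤ u * (1 - u) := (mul_pos hu0 hv0).le
  have huv0 : 0 ≤ u / (1 - u) := (div_pos hu0 hv0).le
  constructor
  · have e1 : u ^ (q - 2) = (u ^ 2) ^ ((q - 2) / 2) := by
      rw [← Real.rpow_natCast_mul hu0.le]; congr 1; push_cast; ring
    have e2 : u ^ 2 = u * (1 - u) * (u / (1 - u)) := by field_simp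
    rw [e1, e2, Real.mul_rpow hP0 huv0]
  · have e1 : (1 - u) ^ (q - 2) = ((1 - u) ^ 2) ^ ((q - 2) / 2) := by
      rw [← Real.rpow_natCast_mul hv0.le]; congr 1; push_cast; ring
    have e2 : (1 - u) ^ 2 = u * (1 - u) / (u / (1 - u)) := by field_simp
    rw [e1, e2, Real.div_rpow hP0 huv0]

/-- Step 3 of the piece lemma (monotonicity in `t`): for `1 ≤ t₀ ≤ t` and `J(u) ≥ max(J(1−u), 0)`,
`t₀J(u) + J(1−u)/t₀ ≤ tJ(u) + J(1−u)/t`. [bookkeeping] -/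
theorem wall_mono_step {Ju Jv t t₀ : ℝ} (ht₀1 : 1 ≤ t₀) (ht : t₀ ≤ t) (hJu : 0 ≤ Ju) (hJd : Jv ≤ Ju) :
    t₀ * Ju + Jv / t₀ ≤ t * Ju + Jv / t := by
  have ht₀0 : 0 < t₀ := by linarith
  have ht0 : 0 < t := by linarith
  have hJvle : Jv / (t * t₀) ≤ Ju := by
    rcases le_or_gt Jv 0 with h | h
    · have : Jv / (t * t₀) ≤ 0 := div_nonpos_iff.mpr (Or.inr ⟨h, by positivity⟩)
      linarith
    · exact (div_le_self h.le (one_le_mul_of_one_le_of_one_le (ht₀1.trans ht) ht₀1)).trans hJd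
  have ht0' : t ≠ 0 := ht0.ne'
  have ht₀' : t₀ ≠ 0 := ht₀0.ne'
  have e : Jv / t₀ - Jv / t = (t - t₀) * (Jv / (t * t₀)) := by
    field_simp
  have h1 : (t - t₀) * (Jv / (t * t₀)) ≤ (t - t₀) * Ju := mul_le_mul_of_nonneg_left hJvle (sub_nonneg.mpr ht)
  linarith [h1, e]

/-- **The piece lemma.** On `u ∈ [1/2, 2/3]`, for a share `c ≤ B_q = ((q−1)/2)·6^{1−q/2}`, a chord
bound `2^{−(q−2)/2} ≤ a + b(q−2)` and the polynomial certificate `G_{a,b}(q,u) ≥ 0` give `𝓘_q(u) ≥ 0`: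
with `P = u(1−u) ≥ 2/9`, `s = 2 − 6P ≤ 3P`, `t = (u/(1−u))^{(q−2)/2} ≥ t₀ = 1 + ((q−2)/2)(1 − (1−u)/u) ≥ 1`
(real Bernoulli), Step 1 bounds the entropy term by `6(q−1)sK·P^{(q−2)/2}(a + b(q−2))`, Step 2/3 bound
`u^{q−2}J(u) + (1−u)^{q−2}J(1−u) = P^{(q−2)/2}(tJ(u) + J(1−u)/t) ≥ P^{(q−2)/2}(t₀J(u) + J(1−u)/t₀)`, and
`G = 4u²t₀·(t₀J(u) + J(1−u)/t₀ − 6(q−1)sK(a + b(q−2)))`. [ours] -/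
theorem wallI_nonneg_of_wallGab {q c u a b : ℝ} (hq : 2 ≤ q)
    (hcB : c ≤ (q - 1) / 2 * (6 : ℝ) ^ (1 - q / 2)) (hu1 : 1 / 2 ≤ u) (hu2 : u ≤ 2 / 3)
    (hch : (1 / 2 : ℝ) ^ ((q - 2) / 2) ≤ a + b * (q - 2)) (hG : 0 ≤ wallGab a b q u) :
    0 ≤ wallI q c u := by
  have hI : wallI q c u = u ^ (q - 2) * wallJ q u + (1 - u) ^ (q - 2) * wallJ q (1 - u) -
      12 * c * lineNsq u ^ (q / 2) * wallK q u := rfl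
  have hGdef : wallGab a b q u = (2 * u + (q - 2) * (2 * u - 1)) ^ 2 * wallJ q u +
      4 * u ^ 2 * wallJ q (1 - u) - 12 * u * (q - 1) * lineNsq u * wallK q u *
      (2 * u + (q - 2) * (2 * u - 1)) * (a + b * (q - 2)) := rfl  -- `lineNsq u` unfolds to `6u² − 6u + 2`
  have hK : 0 ≤ wallK q u := wallK_nonneg hq hu1 hu2
  have hJu : 0 ≤ wallJ q u := wallJ_nonneg hq hu1 hu2
  have hJd : 0 ≤ wallJ q u - wallJ q (1 - u) := wallJ_sub_nonneg hq hu1 hu2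
  have hsdef : lineNsq u = 6 * u ^ 2 - 6 * u + 2 := rfl
  have hu0 : 0 < u := by linarith
  have hv0 : 0 < 1 - u := by linarith
  have hr0 : 0 ≤ (q - 2) / 2 := by linarith
  obtain ⟨hur, hvr⟩ := wall_rpow_split (q := q) hu0 hv0
  rw [hI, hur, hvr]
  set Ju := wallJ q u with hJu_def
  set Jv := wallJ q (1 - u) with hJv_def
  set K := wallK q u with hK_def
  set s := lineNsq u with hs_def
  set P := u * (1 - u) with hP
  set t := (u / (1 - u)) ^ ((q - 2) / 2) with ht
  have hP0 : 0 < P := mul_pos hu0 hv0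
  have hP29 : 2 / 9 ≤ P := by nlinarith
  have hsP : s = 2 - 6 * P := by rw [hsdef, hP]; ring
  have hs0 : 0 < s := by rw [hsP]; nlinarith
  have hs6 : s / 6 ≤ P * (1 / 2) := by rw [hsP]; linarith
  have hPr : 0 ≤ P ^ ((q - 2) / 2) := Real.rpow_nonneg hP0.le _
  -- Step 1
  have hstep1 := wall_entropy_term_le hq hcB hs0 hP0.le hs6 hK hch
  -- Step 2: `t ≥ t₀ ≥ 1`
  have huv0 : 0 < u / (1 - u) := div_pos hu0 hv0
  have ht0 : 0 < t := Real.rpow_pos_of_pos huv0 _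
  set t₀ := 1 + (q - 2) / 2 * (1 - (u / (1 - u))⁻¹) with ht₀
  have ht₀t : t₀ ≤ t := one_add_mul_le_rpow huv0 hr0
  have hinv : (u / (1 - u))⁻¹ = (1 - u) / u := inv_div _ _
  have hvu : (1 - u) / u ≤ 1 := (div_le_one hu0).mpr (by linarith)
  have ht₀1 : 1 ≤ t₀ := by
    have : 0 ≤ (q - 2) / 2 * (1 - (u / (1 - u))⁻¹) := mul_nonneg hr0 (by rw [hinv]; linarith)
    linarith
  have ht₀0 : 0 < t₀ := by linarith
  -- Step 3
  have hmono : t₀ * Ju + Jv / t₀ ≤ t * Ju + Jv / t := wall_mono_step ht₀1 ht₀t hJu (by linarith)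
  -- Step 4: the bracket from the certificate
  have ht₀ne : t₀ ≠ 0 := ht₀0.ne'
  have hune : u ≠ 0 := hu0.ne'
  have hT : 2 * u + (q - 2) * (2 * u - 1) = 2 * u * t₀ := by
    rw [ht₀, hinv]
    field_simp
    ring
  have hGeq : wallGab a b q u =
      4 * u ^ 2 * t₀ * (t₀ * Ju + Jv / t₀ - 6 * (q - 1) * s * K * (a + b * (q - 2))) := by
    rw [hGdef, hT]
    field_simp
    ring
  have hB : 0 ≤ t₀ * Ju + Jv / t₀ - 6 * (q - 1) * s * K * (a + b * (q - 2)) := by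
    have h4 : 0 < 4 * u ^ 2 * t₀ := by positivity
    rw [hGeq] at hG
    exact le_of_mul_le_mul_left (by rwa [mul_zero]) h4
  -- Step 5: assemble
  calc (0 : ℝ) ≤ P ^ ((q - 2) / 2) * (t₀ * Ju + Jv / t₀ - 6 * (q - 1) * s * K * (a + b * (q - 2))) :=
        mul_nonneg hPr hB
    _ ≤ P ^ ((q - 2) / 2) * (t * Ju + Jv / t - 6 * (q - 1) * s * K * (a + b * (q - 2))) :=
        mul_le_mul_of_nonneg_left (by linarith) hPr
    _ = P ^ ((q - 2) / 2) * t * Ju + P ^ ((q - 2) / 2) / t * Jv -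
          6 * (q - 1) * s * K * (P ^ ((q - 2) / 2) * (a + b * (q - 2))) := by ring
    _ ≤ P ^ ((q - 2) / 2) * t * Ju + P ^ ((q - 2) / 2) / t * Jv - 12 * c * s ^ (q / 2) * K := by
        linarith

/-! ## 5. `𝓘_q ≥ 0` at the sharp share, every real `q ≥ 2` -/

/-- `𝓘_q(u) ≥ 0` at `c = c_axi(q)` on the right half `u ∈ [1/2, 2/3]`, every real `q ≥ 2`: dispatch on the four pieces
`q ∈ [2,4]`, `[4,6]`, `[6,10]`, `q ≥ 10` of K27 with the matching chord. [ours] -/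
theorem wallI_cAxi_nonneg_right {q : ℝ} (hq : 2 ≤ q) {u : ℝ} (hu1 : 1 / 2 ≤ u) (hu2 : u ≤ 2 / 3) :
    0 ≤ wallI q (cAxi q) u := by
  have hcB : cAxi q ≤ (q - 1) / 2 * (6 : ℝ) ^ (1 - q / 2) := (cAxi_lt_axiB (by linarith)).le
  rcases le_or_gt q 4 with h4 | h4
  · exact wallI_nonneg_of_wallGab hq hcB hu1 hu2 (half_rpow_chord24 hq h4) (wallGab_nonneg_piece24 hq h4 hu1 hu2)
  rcases le_or_gt q 6 with h6 | h6
  · exact wallI_nonneg_of_wallGab hq hcB hu1 hu2 (half_rpow_chord46 h4.le h6) (wallGab_nonneg_piece46 h4.le h6 hu1 hu2)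
  rcases le_or_gt q 10 with h10 | h10
  · exact wallI_nonneg_of_wallGab hq hcB hu1 hu2 (half_rpow_chord610 h6.le h10)
      (wallGab_nonneg_piece610 h6.le h10 hu1 hu2)
  · exact wallI_nonneg_of_wallGab hq hcB hu1 hu2 (half_rpow_tail h10.le) (wallGab_nonneg_tail h10.le hu1 hu2)

/-- **`𝓘_q(u) ≥ 0` at `c = c_axi(q)` on `[1/3, 2/3]`, every real `q ≥ 2`** (the left half by the mirror symmetry). [ours] -/
theorem wallI_cAxi_nonneg {q : ℝ} (hq : 2 ≤ q) {u : ℝ} (hu1 : 1 / 3 ≤ u) (hu2 : u ≤ 2 / 3) :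
    0 ≤ wallI q (cAxi q) u := by
  rcases le_or_gt (1 / 2) u with h | h
  · exact wallI_cAxi_nonneg_right hq h hu2
  · rw [← wallI_symm]
    exact wallI_cAxi_nonneg_right hq (by linarith) (by linarith)

/-- The same for every share `c ≤ c_axi(q)` (`𝓘_q` is affine and non-increasing in `c` since `K_q ≥ 0`) — in particular at
`c = 0`. [ours, bookkeeping] -/
theorem wallI_nonneg_of_le_cAxi {q c : ℝ} (hq : 2 ≤ q) (hc : c ≤ cAxi q) {u : ℝ} (hu1 : 1 / 3 ≤ u) (hu2 : u ≤ 2 / 3) :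
    0 ≤ wallI q c u := by
  have h := wallI_cAxi_nonneg hq hu1 hu2
  have hK : 0 ≤ wallK q u := by
    rcases le_or_gt (1 / 2) u with h2 | h2
    · exact wallK_nonneg hq h2 hu2
    · have := wallK_nonneg hq (u := 1 - u) (by linarith) (by linarith)
      have e : wallK q (1 - u) = wallK q u := by unfold wallK; ring
      linarith
  have hs : 0 ≤ lineNsq u ^ (q / 2) := Real.rpow_nonneg (lineNsq_pos u).le _
  unfold wallI at h ⊢
  nlinarith [mul_nonneg (mul_nonneg (sub_nonneg.mpr hc) hs) hK]

end TopEig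

end Summit.NavierStokesRegularity.FunctionalMining
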